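import Mathlib
import Summits.CriticalPhenomena.PercolationContinuityZ3.Theorems.PercNearOneGluingNoHeavyLowerTailOddsBernstein
import Summits.CriticalPhenomena.PercolationContinuityZ3.Theorems.PercNearOneGluingNoHeavyLowerTailBandTwoTN
import HarnessLib

/-!
# THREE RAYS, both integer copies below B's ray: the band kernel is totally nonnegative (THEOREM N₃-III)

Support file for the Sahi / Conjecture-P programme of route `PercNearOneGluingNoHeavy`
(`--supports stmt-CriticalPhenomena-4575`, prover prim-l12-p5 gen 43; proof note
`prim-l12-p5/PROOF-THREE-RAYS-g43.md` §1 (LEMMA A), §3 (THEOREM N₃-III)).  No definitions, no named facts, no sorries.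

For `Ψ = (1+p₁u+q₁v)(1+p₂u+q₂v)(1+p_Bu+q_Bv)^θ` the `x`-Laplace reduction (THEOREM R3 of the gen-42 memo) leaves a
matrix whose rows, in the basis `y = 1 + c_B X`, are `A_n y^n + B_n y^{n-1} + C_n y^{n-2}` with (LEMMA A)
`A_n, B_n, C_n` positive combinations of the terminating Gauss sums `Q_c(n) = ₂F₁(-θ, -n; c; g_B)` at the three
levels `c = m+1, m, m-1` (`m = s+2`).  When both integer copies lie on or below `B`'s ray (`w_i = b_i - g_iλ_B ≥ 0`)
and are sub-neutral (`0 ≤ g_i ≤ 1`), the chain condition `4A_{n-1}C_n ≤ B_{n-1}B_n` holds — by c-contiguity,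
THEOREM A′ of `…LowerTailOddsBernstein` (the pure-grabber odds increase, i.e. `(k+m)Q_{m+1}(k)/(kQ_{m+1}(k-1))`
decreases) and two AM–GM steps — so `BandTwoTN.bandTwo_choose_tn` gives:

**THEOREM (`threeRay_below_tn`).**  The kernel `A_n C(n,l) + B_n C(n-1,l) + C_n C(n-2,l)` is totally nonnegative
(hence, by THEOREM R3 and Cauchy–Binet, the three-ray exp-array `F_s` is TP_∞ for every `θ > 0`, `s > -1`).
-/

namespace Summit.CriticalPhenomena.PercolationContinuityZ3.Theorems

namespace BandTwoHyp

open Finset Matrix BandTwoTN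
open scoped Nat

/-! ## THREE RAYS, TYPE III (both integer copies below B's ray): the hypergeometric instantiation

Memo `PROOF-THREE-RAYS-g43.md` §1 (LEMMA A) and §3 (THEOREM N₃-III).  In the `y`-monomial basis the
three-ray `x`-Laplace matrix is `K(n,l) = A_n C(n,l) + B_n C(n-1,l) + C_n C(n-2,l)` (up to positive row/column
scalings) with
`A_n = g₁g₂ n(n-1) Q₊(n-2) + m(g₁+g₂) n Q₀(n-1) + m(m-1) Q₋(n)`,
`B_n = (n/λ)·[(w₁g₂+w₂g₁)(n-1) Q₊(n-2) + m(w₁+w₂) Q₀(n-1)]`, `C_n = (n(n-1)/λ²)·w₁w₂ Q₊(n-2)`,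
where `Q₊, Q₀, Q₋ = ₂F₁(-θ,-·;c;g)` at `c = m+1, m, m-1` (`m = s+2 > 1`, `θ > 0`, `0 ≤ g < 1`, `λ = λ_B > 0`),
`g_i ∈ [0,1]` (sub-neutral copies) and `w_i > 0` (both copies BELOW `B`'s ray).  THEOREM (`threeRay_below_tn`):
`K` is totally nonnegative.  Proof: c-contiguity turns `A, B` into three-term expressions in `Q₊` alone; THEOREM A′
(`pureGrabber_oddsDiff_altSum_nonneg`, Region I since `m > 1`) says the odds `a_k = kQ₊(k-1)/(mQ₀(k))` increase,
i.e. `t_k = (k+m)Q₊(k)/(kQ₊(k-1)) = 1 + 1/a_k` decreases; two AM–GM steps then give the chain condition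
`4A_{n-1}C_n ≤ B_{n-1}B_n`, and `bandTwo_choose_tn` applies. -/

/-- AM–GM step of THEOREM N₃-III (general `n`): with `0 ≤ ḡ_i < α ≤ β`, `w_i > 0` and
`N = αβ - (ḡ₁+ḡ₂)β + ḡ₁ḡ₂ > 0`:  `4 w₁ w₂ N ≤ (w₁(α-ḡ₂)+w₂(α-ḡ₁)) · (w₁(β-ḡ₂)+w₂(β-ḡ₁))`. -/
theorem chain_amgm (α β e₁ e₂ w₁ w₂ : ℝ) (he₁ : 0 ≤ e₁) (he₂ : 0 ≤ e₂) (h₁ : e₁ < α) (h₂ : e₂ < α)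
    (hαβ : α ≤ β) (hw₁ : 0 < w₁) (hw₂ : 0 < w₂) (hN : 0 < α * β - (e₁ + e₂) * β + e₁ * e₂) :
    4 * (w₁ * w₂) * (α * β - (e₁ + e₂) * β + e₁ * e₂) ≤
      (w₁ * (α - e₂) + w₂ * (α - e₁)) * (w₁ * (β - e₂) + w₂ * (β - e₁)) := by
  set N := α * β - (e₁ + e₂) * β + e₁ * e₂ with hNdef
  have ha₁ : 0 < α - e₁ := by linarith
  have ha₂ : 0 < α - e₂ := by linarith
  have hb₁ : 0 < β - e₁ := by linarith
  have hb₂ : 0 < β - e₂ := by linarith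
  have hN1 : N ≤ (β - e₁) * (α - e₂) := by rw [hNdef]; nlinarith
  have hN2 : N ≤ (α - e₁) * (β - e₂) := by rw [hNdef]; nlinarith
  have hD1 : 4 * (w₁ * w₂) * ((α - e₁) * (α - e₂)) ≤ (w₁ * (α - e₂) + w₂ * (α - e₁)) ^ 2 := by
    nlinarith [sq_nonneg (w₁ * (α - e₂) - w₂ * (α - e₁))]
  have hD2 : 4 * (w₁ * w₂) * ((β - e₁) * (β - e₂)) ≤ (w₁ * (β - e₂) + w₂ * (β - e₁)) ^ 2 := by
    nlinarith [sq_nonneg (w₁ * (β - e₂) - w₂ * (β - e₁))]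
  have hD1pos : 0 < w₁ * (α - e₂) + w₂ * (α - e₁) := by positivity
  have hD2pos : 0 < w₁ * (β - e₂) + w₂ * (β - e₁) := by positivity
  have hww : 0 < w₁ * w₂ := mul_pos hw₁ hw₂
  -- (4 w₁w₂ N)^2 ≤ 16 (w₁w₂)^2 (α-e₁)(α-e₂)(β-e₁)(β-e₂) ≤ (D₁ D₂)^2
  have hsq : (4 * (w₁ * w₂) * N) ^ 2 ≤
      ((w₁ * (α - e₂) + w₂ * (α - e₁)) * (w₁ * (β - e₂) + w₂ * (β - e₁))) ^ 2 := by
    have h3 : N * N ≤ ((α - e₁) * (α - e₂)) * ((β - e₁) * (β - e₂)) := by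
      calc N * N ≤ ((β - e₁) * (α - e₂)) * ((α - e₁) * (β - e₂)) :=
            mul_le_mul hN1 hN2 hN.le (by positivity)
        _ = ((α - e₁) * (α - e₂)) * ((β - e₁) * (β - e₂)) := by ring
    calc (4 * (w₁ * w₂) * N) ^ 2 = 16 * (w₁ * w₂) ^ 2 * (N * N) := by ring
      _ ≤ 16 * (w₁ * w₂) ^ 2 * (((α - e₁) * (α - e₂)) * ((β - e₁) * (β - e₂))) :=
          mul_le_mul_of_nonneg_left h3 (by positivity)
      _ = (4 * (w₁ * w₂) * ((α - e₁) * (α - e₂))) * (4 * (w₁ * w₂) * ((β - e₁) * (β - e₂))) := by ring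
      _ ≤ (w₁ * (α - e₂) + w₂ * (α - e₁)) ^ 2 * (w₁ * (β - e₂) + w₂ * (β - e₁)) ^ 2 :=
          mul_le_mul hD1 hD2 (by positivity) (by positivity)
      _ = _ := by ring
  exact (pow_le_pow_iff_left₀ (by positivity) (by positivity) two_ne_zero).1 hsq

/-- AM–GM step of THEOREM N₃-III (`n = 2`): with `0 ≤ ḡ_i`, `ḡ₁ + ḡ₂ < α`, `w_i > 0`:
`4 w₁ w₂ (α - ḡ₁ - ḡ₂) ≤ (w₁ + w₂)(w₁(α-ḡ₂) + w₂(α-ḡ₁))`. -/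
theorem chain_amgm_two (α e₁ e₂ w₁ w₂ : ℝ) (he₁ : 0 ≤ e₁) (he₂ : 0 ≤ e₂) (hα : e₁ + e₂ < α)
    (hw₁ : 0 < w₁) (hw₂ : 0 < w₂) :
    4 * (w₁ * w₂) * (α - e₁ - e₂) ≤ (w₁ + w₂) * (w₁ * (α - e₂) + w₂ * (α - e₁)) := by
  have hX : 0 < α - e₁ - e₂ := by linarith
  have ha₁ : 0 < α - e₁ := by linarith
  have ha₂ : 0 < α - e₂ := by linarith
  have h1 : (α - e₁ - e₂) ^ 2 ≤ (α - e₁) * (α - e₂) := by nlinarith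
  have hD : 4 * (w₁ * w₂) * ((α - e₁) * (α - e₂)) ≤ (w₁ * (α - e₂) + w₂ * (α - e₁)) ^ 2 := by
    nlinarith [sq_nonneg (w₁ * (α - e₂) - w₂ * (α - e₁))]
  have hS : 4 * (w₁ * w₂) ≤ (w₁ + w₂) ^ 2 := by nlinarith [sq_nonneg (w₁ - w₂)]
  have hsq : (4 * (w₁ * w₂) * (α - e₁ - e₂)) ^ 2 ≤ ((w₁ + w₂) * (w₁ * (α - e₂) + w₂ * (α - e₁))) ^ 2 := by
    calc (4 * (w₁ * w₂) * (α - e₁ - e₂)) ^ 2 = (4 * (w₁ * w₂)) * ((4 * (w₁ * w₂)) * (α - e₁ - e₂) ^ 2) := by ring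
      _ ≤ (w₁ + w₂) ^ 2 * ((4 * (w₁ * w₂)) * ((α - e₁) * (α - e₂))) := by
          apply mul_le_mul hS (mul_le_mul_of_nonneg_left h1 (by positivity)) (by positivity) (by positivity)
      _ ≤ (w₁ + w₂) ^ 2 * (w₁ * (α - e₂) + w₂ * (α - e₁)) ^ 2 :=
          mul_le_mul_of_nonneg_left hD (by positivity)
      _ = _ := by ring
  exact (pow_le_pow_iff_left₀ (by positivity) (by positivity) two_ne_zero).1 hsq

section ThreeRay

variable (g : ℝ) (H : ℝ → ℝ → ℕ → ℝ)
  (hH : ∀ a c r, H a c r = ∑ k ∈ range (r + 1), (r.choose k : ℝ) * (-g) ^ k *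
    ((∏ i ∈ range k, (a + i)) / (∏ i ∈ range k, (c + i))))
include hH

set_option maxHeartbeats 400000 in
/-- c-contiguity (g36 (2.1)(A), `γQ(m) = (γ+m)P(m) − mP(m−1)`) in the form used here:
`c · Q_c(n) = (c + n) · Q_{c+1}(n) − n · Q_{c+1}(n−1)` for all `n` (`Q_c = ₂F₁(a, −·; c; g)`); termwise
`c/(c)_k = (c+k)/(c+1)_k` and `(c+n)C(n,k) − nC(n−1,k) = (c+k)C(n,k)`. -/
theorem hyp_c_contig' (a c : ℝ) (hc : 0 < c) (n : ℕ) :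
    c * H a c n = (c + n) * H a (c + 1) n - n * H a (c + 1) (n - 1) := by
  rcases n with _ | r
  · rw [HypergeomCM.hyp_zero g H hH, HypergeomCM.hyp_zero g H hH]; simp
  · rw [Nat.add_sub_cancel]
    have hr : H a (c + 1) r = ∑ k ∈ range (r + 1 + 1), (r.choose k : ℝ) * (-g) ^ k *
        ((∏ i ∈ range k, (a + i)) / (∏ i ∈ range k, (c + 1 + i))) := by
      rw [hH a (c + 1) r, sum_range_succ _ (r + 1), Nat.choose_eq_zero_of_lt (Nat.lt_succ_self r)]
      simp
    rw [hH a c (r + 1), hH a (c + 1) (r + 1), hr, mul_sum, mul_sum, mul_sum, ← sum_sub_distrib]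
    refine sum_congr rfl fun k _ => ?_
    have hPc : 0 < ∏ i ∈ range k, (c + (i : ℝ)) := HypergeomCM.prod_pos_of_pos c hc k
    have hPc1 : 0 < ∏ i ∈ range k, (c + 1 + (i : ℝ)) := HypergeomCM.prod_pos_of_pos (c + 1) (by linarith) k
    -- c · ∏_{i<k}(c+1+i) = (∏_{i<k}(c+i)) · (c+k)
    have e2 : c * ∏ i ∈ range k, (c + 1 + (i : ℝ)) = (∏ i ∈ range k, (c + (i : ℝ))) * (c + k) := by
      rw [← HypergeomCM.prod_succ_shift c k, prod_range_succ]
    -- (r+1) C(r,k) = C(r+1,k) (r+1-k), in ℝ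
    have e1 : ((r : ℝ) + 1) * (r.choose k : ℝ) = ((r + 1).choose k : ℝ) * ((r : ℝ) + 1 - k) := by
      rcases Nat.lt_or_ge (r + 1) k with hk | hk
      · rw [Nat.choose_eq_zero_of_lt hk, Nat.choose_eq_zero_of_lt (by omega)]; simp
      · have h1 := Nat.add_one_mul_choose_eq r k
        have h2 := Nat.choose_succ_right_eq (r + 1) k -- C(r+1,k+1) * (k+1) = C(r+1,k) * (r+1-k)
        have h3 : ((r + 1) * r.choose k : ℕ) = (r + 1).choose k * (r + 1 - k) := by rw [h1, h2]
        have h4 : (((r + 1) * r.choose k : ℕ) : ℝ) = (((r + 1).choose k * (r + 1 - k) : ℕ) : ℝ) := by rw [h3]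
        push_cast [Nat.cast_sub hk] at h4
        linarith
    have hck : (c + (k : ℝ)) ≠ 0 := by positivity
    have q : ((∏ i ∈ range k, (c + (i : ℝ))))⁻¹ = (c + k) * (c * ∏ i ∈ range k, (c + 1 + (i : ℝ)))⁻¹ := by
      rw [e2, mul_inv, ← mul_assoc, mul_comm (c + (k : ℝ)), mul_assoc, mul_inv_cancel₀ hck, mul_one]
    have ecast : (((r + 1 : ℕ) : ℝ)) = (r : ℝ) + 1 := by push_cast; ring
    rw [ecast, div_eq_mul_inv, div_eq_mul_inv, q, mul_inv]
    field_simp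
    linear_combination ((-g) ^ k * (∏ i ∈ range k, (a + (i : ℝ)))) * e1

set_option maxHeartbeats 400000 in
/-- **THEOREM N₃-III in the kernel's hypergeometric vocabulary** (memo §3 with LEMMA A, §1): for
`θ = θ₀ + N > 0`, `m > 1`, `0 ≤ g < 1`, `λ > 0`, sub-neutral below-copies `0 ≤ g₁, g₂ ≤ 1`, `w₁, w₂ > 0`, the
quadratic-row kernel `A_n C(n,l) + B_n C(n-1,l) + C_n C(n-2,l)` with
`A_n = g₁g₂ n(n-1) Q₊(n-2) + m(g₁+g₂) n Q₀(n-1) + m(m-1) Q₋(n)`,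
`B_n = (n/λ)[(w₁g₂+w₂g₁)(n-1) Q₊(n-2) + m(w₁+w₂) Q₀(n-1)]`, `C_n = (n(n-1)/λ²) w₁w₂ Q₊(n-2)`
(`Q₊, Q₀, Q₋ = ₂F₁(-θ,-·;c;g)` at `c = m+1, m, m-1`) is totally nonnegative. -/
theorem threeRay_below_tn (hg0 : 0 ≤ g) (hg1 : g < 1) (θ₀ : ℝ) (h0 : 0 < θ₀) (h1 : θ₀ ≤ 1) (N : ℕ)
    (m : ℝ) (hm : 1 < m) (lam : ℝ) (hlam : 0 < lam) (g₁ g₂ w₁ w₂ : ℝ)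
    (hg₁ : 0 ≤ g₁) (hg₁' : g₁ ≤ 1) (hg₂ : 0 ≤ g₂) (hg₂' : g₂ ≤ 1) (hw₁ : 0 < w₁) (hw₂ : 0 < w₂)
    {k : ℕ} (r c : Fin k → ℕ) (hr : StrictMono r) (hc : StrictMono c) :
    0 ≤ (Matrix.of fun i j =>
      (g₁ * g₂ * (r i : ℝ) * ((r i : ℝ) - 1) * H (-(θ₀ + N)) (m + 1) (r i - 2)
        + m * (g₁ + g₂) * (r i : ℝ) * H (-(θ₀ + N)) m (r i - 1)
        + m * (m - 1) * H (-(θ₀ + N)) (m - 1) (r i)) * ((r i).choose (c j) : ℝ)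
      + ((r i : ℝ) / lam * ((w₁ * g₂ + w₂ * g₁) * ((r i : ℝ) - 1) * H (-(θ₀ + N)) (m + 1) (r i - 2)
        + m * (w₁ + w₂) * H (-(θ₀ + N)) m (r i - 1))) * (((r i) - 1).choose (c j) : ℝ)
      + ((r i : ℝ) * ((r i : ℝ) - 1) / lam ^ 2 * (w₁ * w₂) * H (-(θ₀ + N)) (m + 1) (r i - 2))
        * (((r i) - 2).choose (c j) : ℝ)).det := by
  have hθ : 0 ≤ θ₀ + N := by positivity
  -- the three level sequences and their positivity
  set Qp : ℕ → ℝ := fun n => H (-(θ₀ + N)) (m + 1) n with hQp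
  set Q0 : ℕ → ℝ := fun n => H (-(θ₀ + N)) m n with hQ0
  set Qm : ℕ → ℝ := fun n => H (-(θ₀ + N)) (m - 1) n with hQm
  have hQp_pos : ∀ n, 0 < Qp n := fun n =>
    HypergeomCM.hyp_pos g H hH hg0 hg1 (-(θ₀ + N)) n (m + 1) (by linarith) (by linarith)
  have hQ0_pos : ∀ n, 0 < Q0 n := fun n =>
    HypergeomCM.hyp_pos g H hH hg0 hg1 (-(θ₀ + N)) n m (by linarith) (by linarith)
  have hQm_pos : ∀ n, 0 < Qm n := fun n =>
    HypergeomCM.hyp_pos g H hH hg0 hg1 (-(θ₀ + N)) n (m - 1) (by linarith) (by linarith)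
  -- c-contiguity at c = m and c = m - 1
  have CC1 : ∀ n : ℕ, m * Q0 n = (m + n) * Qp n - n * Qp (n - 1) := fun n => by
    have := hyp_c_contig' g H hH (-(θ₀ + N)) m (by linarith) n
    simpa only [hQ0, hQp] using this
  have CC2 : ∀ n : ℕ, (m - 1) * Qm n = (m - 1 + n) * Q0 n - n * Q0 (n - 1) := fun n => by
    have := hyp_c_contig' g H hH (-(θ₀ + N)) (m - 1) (by linarith) n
    simpa only [hQm, hQ0, sub_add_cancel] using this
  -- the odds a_j = j Q₊(j-1)/(m Q₀(j)) are nondecreasing (THEOREM A′, Region I: m ≥ 1 - θ₀)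
  have hodds : ∀ j : ℕ, (j : ℝ) * Qp (j - 1) / (m * Q0 j) ≤ ((j : ℝ) + 1) * Qp j / (m * Q0 (j + 1)) := by
    intro j
    have h := HypergeomCM.pureGrabber_oddsDiff_altSum_nonneg g H hH hg0 hg1 θ₀ h0 h1 N m (by linarith) (by linarith) 0 j
    simp only [zero_add, sum_range_one, pow_zero, Nat.choose_self, Nat.cast_one, one_mul, add_zero,
      Nat.add_sub_cancel] at h
    have : ((j + 1 : ℕ) : ℝ) = (j : ℝ) + 1 := by push_cast; ring
    rw [this] at h
    simp only [hQp, hQ0]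
    linarith
  -- the band coefficients
  set A : ℕ → ℝ := fun n => g₁ * g₂ * (n : ℝ) * ((n : ℝ) - 1) * Qp (n - 2)
    + m * (g₁ + g₂) * (n : ℝ) * Q0 (n - 1) + m * (m - 1) * Qm n with hA
  set B : ℕ → ℝ := fun n => (n : ℝ) / lam * ((w₁ * g₂ + w₂ * g₁) * ((n : ℝ) - 1) * Qp (n - 2)
    + m * (w₁ + w₂) * Q0 (n - 1)) with hB
  set C : ℕ → ℝ := fun n => (n : ℝ) * ((n : ℝ) - 1) / lam ^ 2 * (w₁ * w₂) * Qp (n - 2) with hC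
  have hApos : ∀ n, 0 < A n := by
    intro n
    simp only [hA]
    have h3 : 0 < m * (m - 1) * Qm n := mul_pos (mul_pos (by linarith) (by linarith)) (hQm_pos n)
    have h2 : 0 ≤ m * (g₁ + g₂) * (n : ℝ) * Q0 (n - 1) :=
      mul_nonneg (mul_nonneg (mul_nonneg (by linarith) (by linarith)) (Nat.cast_nonneg n)) (hQ0_pos _).le
    have h1 : 0 ≤ g₁ * g₂ * (n : ℝ) * ((n : ℝ) - 1) * Qp (n - 2) := by
      rcases Nat.eq_zero_or_pos n with hn | hn
      · subst hn; simp
      · have : (1 : ℝ) ≤ n := by exact_mod_cast hn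
        exact mul_nonneg (mul_nonneg (mul_nonneg (mul_nonneg hg₁ hg₂) (by linarith)) (by linarith))
          (hQp_pos _).le
    linarith
  have hB0 : B 0 = 0 := by simp [hB]
  have hBpos : ∀ n, 1 ≤ n → 0 < B n := by
    intro n hn
    simp only [hB]
    have hn' : (1 : ℝ) ≤ n := by exact_mod_cast hn
    have h1 : 0 ≤ (w₁ * g₂ + w₂ * g₁) * ((n : ℝ) - 1) * Qp (n - 2) :=
      mul_nonneg (mul_nonneg (by positivity) (by linarith)) (hQp_pos _).le
    have h2 : 0 < m * (w₁ + w₂) * Q0 (n - 1) := mul_pos (mul_pos (by linarith) (by linarith)) (hQ0_pos _)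
    exact mul_pos (div_pos (by linarith) hlam) (by linarith)
  have hCnn : ∀ n, 0 ≤ C n := by
    intro n
    simp only [hC]
    rcases Nat.eq_zero_or_pos n with hn | hn
    · subst hn; simp
    · have : (1 : ℝ) ≤ n := by exact_mod_cast hn
      exact mul_nonneg (mul_nonneg (div_nonneg (mul_nonneg (by linarith) (by linarith)) (by positivity))
        (by positivity)) (hQp_pos _).le
  have hC0 : C 0 = 0 := by simp [hC]
  have hC1 : C 1 = 0 := by simp [hC]
  -- the chain condition
  have hchain : ∀ n, 2 ≤ n → 4 * (A (n - 1) * C n) ≤ B (n - 1) * B n := by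
    intro n hn
    have hgb₁ : (0 : ℝ) ≤ 1 - g₁ := by linarith
    have hgb₂ : (0 : ℝ) ≤ 1 - g₂ := by linarith
    rcases Nat.lt_or_ge n 3 with hn3 | hn3
    · -- n = 2
      obtain rfl : n = 2 := by omega
      have hP0 : Qp 0 = 1 := by simp only [hQp]; exact HypergeomCM.hyp_zero g H hH _ _
      have hQ00 : Q0 0 = 1 := by simp only [hQ0]; exact HypergeomCM.hyp_zero g H hH _ _
      -- α' = (m+1) Q₊(1) ; m Q₀(1) = (m+1)Q₊(1) - Q₊(0) ; (m-1) Q₋(1) = m Q₀(1) - Q₀(0)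
      set α := (m + 1) * Qp 1 with hαdef
      have c1 : m * Q0 1 = α - 1 := by
        have := CC1 1; simp only [Nat.cast_one, Nat.sub_self] at this; rw [this, hP0]; ring
      have c2 : (m - 1) * Qm 1 = m * Q0 1 - 1 := by
        have := CC2 1; simp only [Nat.cast_one, Nat.sub_self] at this; rw [this, hQ00]; ring
      have hA1 : A 1 = m * (α - (1 - g₁) - (1 - g₂)) := by
        simp only [hA, Nat.cast_one, sub_self, mul_zero, zero_mul, zero_add, Nat.sub_self, hQ00, mul_one]
        have : m * (m - 1) * Qm 1 = m * ((m - 1) * Qm 1) := by ring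
        rw [this, c2, c1]; ring
      have hB1 : B 1 = m * (w₁ + w₂) / lam := by
        simp only [hB, Nat.cast_one, sub_self, mul_zero, zero_mul, zero_add, Nat.sub_self, hQ00, mul_one]
        ring
      have hB2 : B 2 = 2 / lam * (w₁ * (α - (1 - g₂)) + w₂ * (α - (1 - g₁))) := by
        show (((2 : ℕ) : ℝ)) / lam * ((w₁ * g₂ + w₂ * g₁) * ((((2 : ℕ) : ℝ)) - 1) * Qp (2 - 2)
          + m * (w₁ + w₂) * Q0 (2 - 1)) = _
        rw [show (2 : ℕ) - 2 = 0 from rfl, show (2 : ℕ) - 1 = 1 from rfl, hP0]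
        push_cast
        linear_combination (2 / lam * (w₁ + w₂)) * c1
      have hC2 : C 2 = 2 / lam ^ 2 * (w₁ * w₂) := by
        show (((2 : ℕ) : ℝ)) * ((((2 : ℕ) : ℝ)) - 1) / lam ^ 2 * (w₁ * w₂) * Qp (2 - 2) = _
        rw [show (2 : ℕ) - 2 = 0 from rfl, hP0]
        push_cast
        ring
      have hα : (1 - g₁) + (1 - g₂) < α := by
        have := hApos 1; rw [hA1] at this
        have hm0 : (0 : ℝ) < m := by linarith
        nlinarith
      have key := chain_amgm_two α (1 - g₁) (1 - g₂) w₁ w₂ hgb₁ hgb₂ hα hw₁ hw₂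
      show 4 * (A (2 - 1) * C 2) ≤ B (2 - 1) * B 2
      rw [show (2 : ℕ) - 1 = 1 from rfl, hA1, hC2, hB1, hB2]
      have hm0 : (0 : ℝ) < m := by linarith
      have hl2 : (0 : ℝ) < lam ^ 2 := by positivity
      rw [show 4 * (m * (α - (1 - g₁) - (1 - g₂)) * (2 / lam ^ 2 * (w₁ * w₂)))
          = (2 * m / lam ^ 2) * (4 * (w₁ * w₂) * (α - (1 - g₁) - (1 - g₂))) by ring,
        show m * (w₁ + w₂) / lam * (2 / lam * (w₁ * (α - (1 - g₂)) + w₂ * (α - (1 - g₁))))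
          = (2 * m / lam ^ 2) * ((w₁ + w₂) * (w₁ * (α - (1 - g₂)) + w₂ * (α - (1 - g₁)))) by ring]
      exact mul_le_mul_of_nonneg_left key (by positivity)
    · -- n ≥ 3 : write n = p + 3
      obtain ⟨p, rfl⟩ : ∃ p, n = p + 3 := ⟨n - 3, by omega⟩
      set P1 := Qp (p + 2) with hP1
      set P2 := Qp (p + 1) with hP2
      set P3 := Qp p with hP3
      have hP1p : 0 < P1 := hQp_pos _
      have hP2p : 0 < P2 := hQp_pos _
      have hP3p : 0 < P3 := hQp_pos _
      have hp1 : (0 : ℝ) < (p : ℝ) + 1 := by positivity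
      have hp2 : (0 : ℝ) < (p : ℝ) + 2 := by positivity
      -- t-values α = (n+m-1)P1/((n-1)P2), β = (n+m-2)P2/((n-2)P3)  (n = p+3)
      set α := (m + p + 2) * P1 / ((p + 2) * P2) with hαdef
      set β := (m + p + 1) * P2 / ((p + 1) * P3) with hβdef
      -- α = 1 + 1/a_{p+2}, β = 1 + 1/a_{p+1} with a_j = j Q₊(j-1)/(m Q₀ j) increasing
      have cQ0a : m * Q0 (p + 2) = (m + p + 2) * P1 - (p + 2) * P2 := by
        have := CC1 (p + 2); rw [show p + 2 - 1 = p + 1 by omega] at this; push_cast at this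
        rw [this]; ring
      have cQ0b : m * Q0 (p + 1) = (m + p + 1) * P2 - (p + 1) * P3 := by
        have := CC1 (p + 1); rw [show p + 1 - 1 = p by omega] at this; push_cast at this
        rw [this]; ring
      have cQm : m * ((m - 1) * Qm (p + 2)) = (m + p + 1) * (m * Q0 (p + 2)) - (p + 2) * (m * Q0 (p + 1)) := by
        have := CC2 (p + 2); rw [show p + 2 - 1 = p + 1 by omega] at this; push_cast at this
        rw [this]; ring
      have hm0 : (0 : ℝ) < m := by linarith
      -- positivity of m Q0 gives α > 1, β > 1
      have hQ0a : 0 < (m + p + 2) * P1 - (p + 2) * P2 := by rw [← cQ0a]; exact mul_pos hm0 (hQ0_pos _)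
      have hQ0b : 0 < (m + p + 1) * P2 - (p + 1) * P3 := by rw [← cQ0b]; exact mul_pos hm0 (hQ0_pos _)
      have hα1 : 1 < α := by
        rw [hαdef, lt_div_iff₀ (by positivity)]; linarith
      have hβ1 : 1 < β := by
        rw [hβdef, lt_div_iff₀ (by positivity)]; linarith
      -- monotonicity of the odds: a_{p+1} ≤ a_{p+2}  ⟹  α ≤ β
      have hαβ : α ≤ β := by
        have ho := hodds (p + 1)
        rw [show p + 1 - 1 = p by omega, show p + 1 + 1 = p + 2 by omega] at ho
        push_cast at ho
        -- a_{p+1} = (p+1) P3/(m Q0(p+1)),  a_{p+2} = (p+2) P2/(m Q0(p+2))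
        rw [cQ0b, cQ0a] at ho
        have e2 : ((p : ℝ) + 1 + 1) * Qp (p + 1) / ((m + p + 2) * P1 - (p + 2) * P2)
            = ((p : ℝ) + 2) * P2 / ((m + p + 2) * P1 - (p + 2) * P2) := by
          rw [hP2]; ring
        rw [e2] at ho
        -- α - 1 = ((m+p+2)P1 - (p+2)P2)/((p+2)P2) = 1/a_{p+2},  β - 1 = 1/a_{p+1}
        have hα' : α - 1 = ((m + p + 2) * P1 - (p + 2) * P2) / ((p + 2) * P2) := by
          rw [hαdef]; field_simp
        have hβ' : β - 1 = ((m + p + 1) * P2 - (p + 1) * P3) / ((p + 1) * P3) := by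
          rw [hβdef]; field_simp
        have : α - 1 ≤ β - 1 := by
          rw [hα', hβ']
          rw [div_le_div_iff₀ (by positivity) (by positivity)]
          rw [div_le_div_iff₀ hQ0b hQ0a] at ho
          linarith [ho]
        linarith
      -- identities: A(n-1) = (n-1)(n-2) P3 N, B(n) = n(n-1)P2 D₁/λ, B(n-1) = (n-1)(n-2) P3 D₂/λ, C(n) = n(n-1) w₁w₂ P2/λ²
      set Nq := α * β - ((1 - g₁) + (1 - g₂)) * β + (1 - g₁) * (1 - g₂) with hNq
      set D₁ := w₁ * (α - (1 - g₂)) + w₂ * (α - (1 - g₁)) with hD₁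
      set D₂ := w₁ * (β - (1 - g₂)) + w₂ * (β - (1 - g₁)) with hD₂
      have hpp2 : ((p : ℝ) + 2) * P2 ≠ 0 := by positivity
      have hpp1 : ((p : ℝ) + 1) * P3 ≠ 0 := by positivity
      have iA : A (p + 2) = ((p : ℝ) + 2) * ((p : ℝ) + 1) * P3 * Nq := by
        have eA : A (p + 2) = g₁ * g₂ * ((p : ℝ) + 2) * ((p : ℝ) + 1) * P3
            + (g₁ + g₂) * ((p : ℝ) + 2) * (m * Q0 (p + 1)) + m * ((m - 1) * Qm (p + 2)) := by
          simp only [hA]; rw [show p + 2 - 2 = p by omega, show p + 2 - 1 = p + 1 by omega]; push_cast; ring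
        rw [eA, cQm, cQ0a, cQ0b, hNq, hαdef, hβdef]
        field_simp
        ring
      have iBn : B (p + 3) = ((p : ℝ) + 3) * ((p : ℝ) + 2) * P2 * D₁ / lam := by
        have eB : B (p + 3) = ((p : ℝ) + 3) / lam * ((w₁ * g₂ + w₂ * g₁) * ((p : ℝ) + 2) * P2
            + (w₁ + w₂) * (m * Q0 (p + 2))) := by
          simp only [hB]; rw [show p + 3 - 2 = p + 1 by omega, show p + 3 - 1 = p + 2 by omega]; push_cast; ring
        rw [eB, cQ0a, hD₁, hαdef]
        field_simp
        ring
      have iBm : B (p + 2) = ((p : ℝ) + 2) * ((p : ℝ) + 1) * P3 * D₂ / lam := by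
        have eB : B (p + 2) = ((p : ℝ) + 2) / lam * ((w₁ * g₂ + w₂ * g₁) * ((p : ℝ) + 1) * P3
            + (w₁ + w₂) * (m * Q0 (p + 1))) := by
          simp only [hB]; rw [show p + 2 - 2 = p by omega, show p + 2 - 1 = p + 1 by omega]; push_cast; ring
        rw [eB, cQ0b, hD₂, hβdef]
        field_simp
        ring
      have iC : C (p + 3) = ((p : ℝ) + 3) * ((p : ℝ) + 2) * (w₁ * w₂) * P2 / lam ^ 2 := by
        simp only [hC]; rw [show p + 3 - 2 = p + 1 by omega]; push_cast; ring
      -- N > 0 from A > 0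
      have hNpos : 0 < Nq := by
        have := hApos (p + 2); rw [iA] at this
        have hpos3 : 0 < ((p : ℝ) + 2) * ((p : ℝ) + 1) * P3 := by positivity
        exact (mul_pos_iff_of_pos_left hpos3).1 this
      have key := chain_amgm α β (1 - g₁) (1 - g₂) w₁ w₂ hgb₁ hgb₂ (by linarith) (by linarith) hαβ hw₁ hw₂
        (by rw [hNq] at hNpos; linarith)
      show 4 * (A (p + 3 - 1) * C (p + 3)) ≤ B (p + 3 - 1) * B (p + 3)
      rw [show p + 3 - 1 = p + 2 by omega, iA, iC, iBm, iBn]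
      have hF : 0 ≤ ((p : ℝ) + 2) * ((p : ℝ) + 1) * P3 * (((p : ℝ) + 3) * ((p : ℝ) + 2) * P2) / lam ^ 2 := by
        positivity
      rw [show 4 * ((↑p + 2) * (↑p + 1) * P3 * Nq * ((↑p + 3) * (↑p + 2) * (w₁ * w₂) * P2 / lam ^ 2))
          = ((↑p + 2) * (↑p + 1) * P3 * ((↑p + 3) * (↑p + 2) * P2) / lam ^ 2) * (4 * (w₁ * w₂) * Nq) by ring,
        show (↑p + 2) * (↑p + 1) * P3 * D₂ / lam * ((↑p + 3) * (↑p + 2) * P2 * D₁ / lam)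
          = ((↑p + 2) * (↑p + 1) * P3 * ((↑p + 3) * (↑p + 2) * P2) / lam ^ 2) * (D₁ * D₂) by ring]
      refine mul_le_mul_of_nonneg_left ?_ hF
      exact key
  -- conclude with the abstract criterion
  have main := bandTwo_choose_tn A B C hApos hBpos hB0 hCnn hC0 hC1 hchain r c hr hc
  simpa only [hA, hB, hC, hQp, hQ0, hQm] using main

end ThreeRay

end BandTwoHyp

end Summit.CriticalPhenomena.PercolationContinuityZ3.Theorems
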